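import Summits.RiemannHypothesis.RiemannHypothesis.Theses.JensenLogBand
import HarnessLib

/-!
# Route JensenLogBand — the assembly item (RH-FREE)

Cell rh-jensen, LADDER-RH rung J-P(P3) «log band». The assembly item `Assembly` of the route file
`Theses/JensenLogBand.lean` (stmt-RiemannHypothesis-19916) is the implication
`XiDerivEdgeReal → XiDerivBandRealAllRates → WideBandOfBeyond → LogBandArith → JensenLogBandEighth`,
which is exactly the planner's kernel-checked deciding theorem `…Theses.JensenLogBand.closes`
(the tree floor `EffectiveKimLee.xiSq_derivZeros_nonreal_far_of_le` enters there by name).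
WHAT THIS IS NOT: the assembly proves nothing about the two cruxes (EDGE, BAND); a hyperbolicity
range with `N(d) → ∞` is inside Farmer's class — nothing here bears on zeros of `ζ` off the line or
the truth of RH. (prover-rh-jensen-eng-2-g5-0, 2026-08-27.)
-/

set_option linter.dupNamespace false

namespace Summit.RiemannHypothesis.RiemannHypothesis.Theorems.JensenPolynomials.LogBand

/-- **The assembly item of route JensenLogBand** (`EDGE → BAND → WideBandOfBeyond → LogBandArith →
JensenLogBandEighth`): the route file's deciding theorem `closes`, by name. RH-FREE. -/
theorem assembly_holds : Summit.RiemannHypothesis.RiemannHypothesis.Theses.JensenLogBand.Assembly := by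
  unfold Summit.RiemannHypothesis.RiemannHypothesis.Theses.JensenLogBand.Assembly
  -- buildfix (bf3-g25, 2026-08-27): `closes` rev of 03:07Z (planner rh-jensen-theory g10) DERIVES the edge realness
  -- from the band hypothesis and no longer takes `hE`; the assembly item keeps its four binders, the first is unused.
  exact fun _hE hB hW hA =>
    Summit.RiemannHypothesis.RiemannHypothesis.Theses.JensenLogBand.closes hB hW hA

end Summit.RiemannHypothesis.RiemannHypothesis.Theorems.JensenPolynomials.LogBand
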